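/-
Copyright (c) 2026. All rights reserved.
Released under Apache 2.0 license as described in the file LICENSE.
Authors: abc-iut cell, wave-6 cone prover seat abc-iut-w6-d025 (gen 4; row «PROP58vii-ARC-GENUINE», successor N4 of the
clause map), over abc-iut-L4-t3's interface add-on `LogFrobeniusSetting.IotaAnMono` (`LogFrobeniusIotaAnMono.lean`) and this
seat's `MonoAnalyticArchGammaFunctor` / `LogFrobeniusArchGenuineMonoAn` / `AutHolFieldFunctorMonoAnalyticization`.
-/
import Literature.AnabelianGeometry.AbsoluteAnabelian.AutHolFieldFunctorMonoAnalyticization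
import Literature.AnabelianGeometry.AbsoluteAnabelian.LogFrobeniusIotaAnMono
import HarnessLib

/-!
# [AbsTopIII] Prop 5.8 (vii), `ι^{An⊢⊞}_{w,ε}` for `w ∈ W_arc`: abc-iut-L4-t3's add-on `IotaAnMono` INHABITED at the archimedean
# settings `archGenuineMonoAn 𝔄` and `archGenuineMonoAnChart 𝔄`

S. Mochizuki, *Topics in absolute anabelian geometry III*, J. Math. Sci. Univ. Tokyo 22 (2015) [MochizukiAbsTopIII2015]; manuscript
`paper:url-5493eb38cbb7`, Prop 5.8 (vii) p. 142 l. 11–17 ("and a natural transformation `ι^{An⊢⊞}_{w,ε} : ψ^{An⊢⊞}_{w,ν₁} →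
ψ^{An⊢⊞}_{w,ν₂}` for each edge `ε` of `Γ⃗×_w` running from a vertex `ν₁` to a vertex `ν₂`"), Def 5.4 (v) p. 127 (`Γ⃗×_arc` = the
single shell-arrow `k∼ ↠ k×`).

PATTERN = abc-iut-w4-d095's `nonarchGenuineMonoAnPf_iotaAnMono` (`LogFrobeniusMonoGenuineProp58viiPf.lean`), mirrored:
* `TMMono.arcContainerMap`, `TMMono.containerMapArc` — the container map along an edge of `Γ⃗×_w`: at an ARCHIMEDEAN `w` the
  unique core edge `k∼ ↠ k×` ↦ `gammaArc` (file 1/2: covering × identity, natural in `G`); at a nonarchimedean `w` of this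
  archimedean-only model the identity of the stand-in `k∼` (honest limit (L2) of `LogFrobeniusArchGenuineMonoAn.lean`);
* `TMMono.ιArcTS b ε hε : ψArc b ν₁ ⟶ ψArc b ν₂` — identity on the base, container map on the `TB⊞`-component; along `k∼ ↠ k×` it
  IS `ιArc` (`ιArcTS_arch_shell`, rfl);
* `LogFrobeniusSetting.archGenuineMonoAn_iotaAnMono`, `archGenuineMonoAnChart_iotaAnMono` — the add-on INHABITED at both
  archimedean settings, `ι^{An⊢⊞}` lying over `Th⊢[Z]` ON THE NOSE (`hψ` = the identity isomorphisms from `_ψOver`);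
  `exists_arch_setting_iotaAnMono`.
No new `Prop`; data assembled from landed declarations BY NAME.  MODEL-LEVEL; refereed pre-IUT material; nothing here bears on
[IUTchIII] Cor. 3.12; no side taken; typed ≠ proved elsewhere.
-/

set_option autoImplicit false

noncomputable section

open CategoryTheory

universe v u

namespace Literature.AnabelianGeometry.AbsoluteAnabelian

namespace TMMono

/-- The container map along an edge of `Γ⃗^log_arc` that lies in `Γ⃗×_arc` — only the shell-arrow `k∼ ↠ k×` does — is
`gammaArc`; the other two arrows are excluded by `InCore`. [cite: MochizukiAbsTopIII2015, Prop 5.8 (vii) p. 142] -/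
def arcContainerMap : {ν₁ ν₂ : ArchVertex} → (ε : ArchEdge ν₁ ν₂) → ε.InCore →
    (arcContainer.{v} true ν₁ ⟶ arcContainer.{v} true ν₂)
  | _, _, .shell, _ => gammaArc
  | _, _, .postLogId, h => (h.2).elim
  | _, _, .multToSpaceLink, h => (h.1).elim

/-- The container map along an edge of `Γ⃗×_w`, both kinds of place (nonarchimedean `w`: identity of the stand-in `k∼`).
[cite: MochizukiAbsTopIII2015, Prop 5.8 (vii) p. 142] -/
def containerMapArc : (b : Bool) → {ν₁ ν₂ : LogVertex b} → (ε : LogEdgeTS b ν₁ ν₂) → ε.InCore →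
    (arcContainer.{v} b ν₁ ⟶ arcContainer.{v} b ν₂)
  | true, _, _, ε, hε => arcContainerMap ε hε
  | false, _, _, _, _ => 𝟙 kTilde

/-- **`ι^{An⊢⊞}_{w,ε}` for EVERY edge `ε` of `Γ⃗×_w`** at the archimedean model: the identity on the base component, the container
map on the `TB⊞`-component. [cite: MochizukiAbsTopIII2015, Prop 5.8 (vii) p. 142] -/
def ιArcTS (b : Bool) {ν₁ ν₂ : LogVertex b} (ε : LogEdgeTS b ν₁ ν₂) (hε : ε.InCore) : ψArc.{v} b ν₁ ⟶ ψArc.{v} b ν₂ :=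
  Functor.whiskerLeft (inducedFunctor _) (NatTrans.prod' (𝟙 (𝟭 TMMono.{v})) (containerMapArc b ε hε))

/-- Along the archimedean shell-arrow `k∼ ↠ k×` this IS `ιArc` of `LogFrobeniusArchGenuineMonoAn.lean`.
[cite: MochizukiAbsTopIII2015, Prop 5.8 (vii) p. 142] -/
theorem ιArcTS_arch_shell (h : LogEdgeTS.InCore (b := true) ArchEdge.shell) : ιArcTS.{v} true ArchEdge.shell h = ιArc := rfl

/-- `ι^{An⊢⊞}` lies over the identity of the base ("morphisms induced by `Th⊢[Z]`"). [cite: MochizukiAbsTopIII2015, Prop 5.8 (vii) p. 142] -/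
theorem ιArcTS_app_fst (b : Bool) {ν₁ ν₂ : LogVertex b} (ε : LogEdgeTS b ν₁ ν₂) (hε : ε.InCore) (X : AnArc.{v}) :
    ((ιArcTS b ε hε).app X).1 = 𝟙 X.1 := rfl

end TMMono

namespace LogFrobeniusSetting

variable (𝔄 : AutHolFieldFunctor.{u}) (Vmod : Type (u + 1)) (isArc : Vmod → Bool)

/-- `ψ` over `ℰ⊢` on the nose ⇒ the identity isomorphisms are a legitimate `hψ` for the add-on, at `archGenuineMonoAn`.
[cite: MochizukiAbsTopIII2015, Definition 5.6 (iv) p. 136] -/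
def archGenuineMonoAn_ψOverIso (w : Vmod) (j : {ν : LogVertex (isArc w) // ν.IsCross}) :
    (archGenuineMonoAn 𝔄 Vmod isArc).ψAnMono w j ⋙ (archGenuineMonoAn 𝔄 Vmod isArc).forgetMono w ⋙
        (archGenuineMonoAn 𝔄 Vmod isArc).toEmono w ≅
      (archGenuineMonoAn 𝔄 Vmod isArc).κAnMono.inverse :=
  eqToIso (archGenuineMonoAn_ψOver 𝔄 Vmod isArc w j)

/-- ★ **abc-iut-L4-t3's add-on `IotaAnMono` INHABITED at the archimedean setting `archGenuineMonoAn 𝔄`**: for every edge of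
`Γ⃗×_w` — at an archimedean `w` the shell-arrow `k∼ ↠ k×`, realised by the FUNCTORIAL `gammaArc` — a natural transformation
`ψ_{ν₁} ⟶ ψ_{ν₂}` lying over `Th⊢[Z]` ON THE NOSE. [cite: MochizukiAbsTopIII2015, Prop 5.8 (vii) p. 142] -/
def archGenuineMonoAn_iotaAnMono :
    (archGenuineMonoAn 𝔄 Vmod isArc).IotaAnMono (archGenuineMonoAn_ψOverIso 𝔄 Vmod isArc) where
  ι w _ _ ε hε := TMMono.ιArcTS (isArc w) ε hε
  ι_over w ν₁ ν₂ ε hε X := by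
    simp only [archGenuineMonoAn_ψOverIso, eqToIso.hom, eqToIso.inv, eqToHom_app, eqToHom_trans]
    rfl

/-- The same `hψ` at the setting with the GENUINE arrow `ℰ• → ℰ⊢` (`archGenuineMonoAnChart 𝔄`).
[cite: MochizukiAbsTopIII2015, Definition 5.6 (iv) p. 136] -/
def archGenuineMonoAnChart_ψOverIso (w : Vmod) (j : {ν : LogVertex (isArc w) // ν.IsCross}) :
    (archGenuineMonoAnChart 𝔄 Vmod isArc).ψAnMono w j ⋙ (archGenuineMonoAnChart 𝔄 Vmod isArc).forgetMono w ⋙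
        (archGenuineMonoAnChart 𝔄 Vmod isArc).toEmono w ≅
      (archGenuineMonoAnChart 𝔄 Vmod isArc).κAnMono.inverse :=
  eqToIso (archGenuineMonoAnChart_ψOver 𝔄 Vmod isArc w j)

/-- ★ **The add-on INHABITED at `archGenuineMonoAnChart 𝔄`** as well (same `ψ`/`ι` rows).
[cite: MochizukiAbsTopIII2015, Prop 5.8 (vii) p. 142] -/
def archGenuineMonoAnChart_iotaAnMono :
    (archGenuineMonoAnChart 𝔄 Vmod isArc).IotaAnMono (archGenuineMonoAnChart_ψOverIso 𝔄 Vmod isArc) where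
  ι w _ _ ε hε := TMMono.ιArcTS (isArc w) ε hε
  ι_over w ν₁ ν₂ ε hε X := by
    simp only [archGenuineMonoAnChart_ψOverIso, eqToIso.hom, eqToIso.inv, eqToHom_app, eqToHom_trans]
    rfl

/-- **Prop 5.8 (vii) at the archimedean places, `ψ` AND `ι` present**: a §5 setting over the Aut-holomorphic model with the
genuine mono-analyticization `EA → TM⊢`, print's `An⊢[𝒩⊢⊞_w]`, `ψ^{An⊢⊞}` over `ℰ⊢` on the nose, and the `ι^{An⊢⊞}` add-on inhabited.
[cite: MochizukiAbsTopIII2015, Prop 5.8 (vii) p. 142] -/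
theorem exists_arch_setting_iotaAnMono :
    ∃ (L : LogFrobeniusSetting Vmod isArc)
      (hψ : ∀ (w : Vmod) (j : {ν : LogVertex (isArc w) // ν.IsCross}),
        L.ψAnMono w j ⋙ L.forgetMono w ⋙ L.toEmono w ≅ L.κAnMono.inverse),
      L.X = Up (HolTFPair 𝔄) ∧ L.Emono = TMMono.{u + 1} ∧ L.AnMono = TMMono.AnArc.{u + 1} ∧ Nonempty (L.IotaAnMono hψ) :=
  ⟨archGenuineMonoAnChart 𝔄 Vmod isArc, archGenuineMonoAnChart_ψOverIso 𝔄 Vmod isArc, rfl, rfl, rfl,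
    ⟨archGenuineMonoAnChart_iotaAnMono 𝔄 Vmod isArc⟩⟩

end LogFrobeniusSetting

end Literature.AnabelianGeometry.AbsoluteAnabelian

end
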